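/-
Copyright (c) 2026 the pub-hodgecm-mathlib formalisation cell (harness21).  Prover seat hodgecm-mathlib-LH4-p14 (g8) (L1 valve hand; (P-dec) writer per the K1b∕ρ desk's
handoff 2026-09-05T00:32Z), Track B «K2-LIT» ∕ hLiu418 #184♮, socket #41 KIND 1, package (K1b-♮), letter (P-dec) ∕ (dec-0′):
THE FULL FRAME CHANGE — two see-saw ∕ Levi ∕ line-chart ∕ row-section frames give PROPORTIONAL rank-one line Whittaker values.  THEOREMS ONLY.
-/
import Summits.HodgeConjecture.HodgeConjecture.Theorems.K2LiuKindOneLineFrameIndependence           -- ★ p863703 (dec-0): `eq_of_real_smul_eq`, `eq_of_eq_on_one_lt`, the pin frame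
import HarnessLib

/-!
# Crux `HLiu418`, socket #41, KIND 1 — (P-dec) letter (dec-0′) `K2LiuKindOneLineFrameChange`: TWO FRAMES GIVE PROPORTIONAL LINE WHITTAKER VALUES

Cell `hodgecm-mathlib`, crux item hLiu418 = `stmt-HodgeConjecture-24832` (helper lane `--supports … --as helper`, count-neutral), route of record `HCCMUnconditional`;
squad K2 ∕ K2Liu, road `K2_Liu`, socket #41, KIND 1, package (K1b-♮).  The OF-RECORD letters `hWdec1 ∕ hWdec0` of ★ p863630 quantify the `D`-polynomial decay over
EVERY frame `F = (eA eB dA dB, Λ, μ, nB, γ)` (constants may depend on `F`, not on the index).  ★ p863703 (dec-0) moved `γ` and `S'` inside ONE frame with the SAME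
constant; THIS FILE moves the WHOLE frame: for two frames `F₁, F₂` of the same enumeration there is ONE `c > 0` (the ratio `C₁ ∕ C₂` of the two ★ p862785 constants —
independent of the index `S`, the sections' values, the transported indices, `s` and the point) with `W(F₂)(s, x) = c • W(F₁)(s, x)` on the whole window `{0 < re s}`
(both are `Cᵢ⁻¹ •` the same middle term on `{1 < re s}`; ★ p862749 + the identity theorem continue).  CONSEQUENCE for the (P-dec) head: the decay need only be proved in ONE
frame of the payer's choice (e.g. the normalised row section `γ₀` of ★ p863259 ∕ p863374 and the corner index `S' := σ♭ E₁₁` of ★ `conj_index_eq_single`); ★ p863630's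
∀-frame letters follow with constants `× c`.
* **`exists_whittakerDelta_line_eq_smul_of_frames`** (`e (1,0) = 1`) and **`exists_whittakerDelta_line_eq_smul_of_frames_inl`** (`e (1,0) = 0`).
HONEST LABEL.  Count-neutral helper; closes no socket: `HC_CM` is proved only modulo the 7 printed citations (2 remaining named inputs: hLiu418 =
`stmt-HodgeConjecture-24832`, h413 = `stmt-HodgeConjecture-24833`) until rung 0 closes.

## References
* [KudlaRallis1994] S. Kudla, S. Rallis, Ann. of Math. 140 (1994): §2 (2.10)–(2.12).
* [MoeglinWaldspurger1995] C. Mœglin, J.-L. Waldspurger, *Spectral decomposition and Eisenstein series* (1995): II.1.7, IV.1.9.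
* [Conway1978] J. B. Conway, *Functions of One Complex Variable I*: IV.3 (identity theorem).
-/

set_option autoImplicit false
-- the mandated namespace repeats the single-problem summit's segment (`HodgeConjecture.HodgeConjecture`)
set_option linter.dupNamespace false

noncomputable section

open scoped Matrix ENNReal NNReal Topology ComplexConjugate
open NumberField IsDedekindDomain MeasureTheory MeasureTheory.Measure Filter Set Function
open Literature.NumberTheory.Automorphic Literature.NumberTheory.Automorphic.UnitaryGroup Literature.NumberTheory.GaloisRepresentations
open Literature.NumberTheory.GelbartRogawski1991 Literature.NumberTheory.GelbartRogawski1991.GRConstruction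
open Literature.NumberTheory.GelbartRogawski1991.AdaptedBlocks
open Literature.NumberTheory.K2Lit.SiegelDoubled Literature.MeasureTheory.Group
open Literature.NumberTheory.Automorphic.IdeleClassGroup
open UnitaryDualPair

namespace Summit.HodgeConjecture.HodgeConjecture.Cruxes.HLiu418.K2LiuKindOneLineFrameChange

open K2LiuSiegelUnipotentFourierDefs K2LiuSiegelUnipotentCharacters K2LiuUnipotentCoveringWeight K2LiuSiegelFourierCoeffDelta
open K2LiuSiegelRationalLeviDecomposition K2LiuSiegelMiddleCellSortedPattern K2LiuSiegelMiddleCellLeviCriterion K2LiuSiegelBruhatMiddleCellDelta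
open K2LiuRankOneMiddleTermWhittakerLine (exists_middle_cell_rankOne_eq_whittakerDelta_line)
open K2LiuRankOneMiddleTermWhittakerLineInl (exists_middle_cell_rankOne_eq_whittakerDelta_line_inl)
open K2LiuKindOneLineWhittakerHolomorphyCorner (differentiableOn_whittakerDelta_cornerTranslate_line)
open K2LiuKindOneLinePin (differentiableOn_whittakerDelta_blkD_inl_line)
open K2LiuLineCornerChartHaar (isHaarMeasure_map_lineChart)
open K2LiuUnipDeltaConjMeasurePreserving (measurePreserving_conj_levi)
open K2LiuSiegelMiddleTermStabilizerWeight (exists_stabilizer_coveringWeight)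
open K2LiuSiegelEisensteinConstantTermFiniteness (lintegral_tsum_enorm_mul_weight_ne_top)
open K2LiuEisensteinContinuationGlue (eqOn_of_eqOn_halfPlane)
open K2LiuKindOneLineFrameIndependence (eq_of_real_smul_eq eq_of_eq_on_one_lt)

/-- **(dec-0′) THE FULL FRAME CHANGE** (corner enumeration `e (1,0) = 1`).  Socket prefix of #41 at `n = 2`; TWO frames `F₁ = (eA₁ eB₁ dA₁ dB₁, Λ₁, μ₁, nB₁, γ₁)`,
`F₂ = (…₂)` BY VALUE (★ p863230's frame bytes, twice).  THEN `∃ c > 0` such that for every rank-one `T_L`-skew `S = u ⊗ w`, transported indices `S'₁` (w.r.t. `Λ₁γ₁[w]`),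
`S'₂` (w.r.t. `Λ₂γ₂[w]`), every `s` with `0 < re s` and every `x`: `W(F₂)(s, x) = c • W(F₁)(s, x)`.  (`c = C₁ ∕ C₂` for the two ★ p862785 constants; equality on `{1 < re s}` through the
middle term, continued by ★ p862749 ∕ ★ p863263 §2 and `eq_of_eq_on_one_lt`.) [cite: KudlaRallis1994, §2 (2.10)–(2.12)] [cite: MoeglinWaldspurger1995, II.1.7, IV.1.9] [cite: Conway1978, IV.3] -/
theorem exists_whittakerDelta_line_eq_smul_of_frames
    (L : Type) [Field L] [NumberField L] [IsCMField L] (e : Fin 2 × Fin 1 ≃ Fin 2)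
    (dV : Fin 2 → L) (hdV : ∀ i, IsCMField.complexConj L (dV i) = dV i) (hdV0 : ∀ i, dV i ≠ 0)
    (dW : Fin 1 → L) (hdW : ∀ i, IsCMField.complexConj L (dW i) = dW i) (hdW0 : ∀ i, dW i ≠ 0)
    (lam : IdeleClassGroup L →ₜ* Circle) (_hlam : IsConjugateSymplectic L lam) (_hw : HasWeight L lam 1)
    (𝒦 : IwasawaDatum L e dV hdV dW hdW) (_h𝒦 : 𝒦.IsStd) (f : ℂ → HA L e dV hdV dW hdW → ℂ)
    (hstd : IsStandardSectionFamily 𝒦 (toHeckeCharacter L lam⁻¹) f) (hcont : ∀ s, Continuous (f s))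
    [MeasurableSpace (unipDelta L e dV hdV dW hdW)] [BorelSpace (unipDelta L e dV hdV dW hdW)]
    (νN : Measure (unipDelta L e dV hdV dW hdW)) [νN.IsHaarMeasure]
    (β : unipDelta L e dV hdV dW hdW → ℝ≥0∞) (hβ : IsCoveringWeight (unipDeltaRat L e dV hdV dW hdW) β)
    (_hβ0 : ∫⁻ u, β u ∂νN ≠ 0) (hβtop : ∫⁻ u, β u ∂νN ≠ ∞)
    {K : Set (unipDelta L e dV hdV dW hdW)} (hK : IsCompact K) (hβK : ∀ u, β u ≤ K.indicator 1 u)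
    (wq : unipDeltaRat L e dV hdV dW hdW → ratH L e dV hdV dW hdW)
    (hwq : ∀ ν, ((wq ν : ratH L e dV hdV dW hdW) : HA L e dV hdV dW hdW) = weylDelta L e dV hdV dW hdW * ((ν : unipDelta L e dV hdV dW hdW) : HA L e dV hdV dW hdW))
    -- the enumeration (shared by both frames)
    (he : e (1, 0) = 1)
    [MeasurableSpace (AdeleRing (𝓞 (Fp L)) (Fp L))] [BorelSpace (AdeleRing (𝓞 (Fp L)) (Fp L))]
    -- FRAME 1
    -- the see-saw datum `V = A ⊕ B` BY VALUE (the writer takes `eA₁ = eB₁` the unique equivalence, `dA₁ _ := dV 0`, `dB₁ _ := dV 1`, `borel` instances)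
    {n₁ n₂ : ℕ} (eA₁ : Fin 1 × Fin 1 ≃ Fin n₁) (eB₁ : Fin 1 × Fin 1 ≃ Fin n₂)
    (dA₁ : Fin 1 → L) (hdA₁ : ∀ i, IsCMField.complexConj L (dA₁ i) = dA₁ i)
    (dB₁ : Fin 1 → L) (hdB₁ : ∀ i, IsCMField.complexConj L (dB₁ i) = dB₁ i) (hdB0₁ : ∀ i, dB₁ i ≠ 0)
    (hVA₁ : ∀ i, dV (Fin.castAdd 1 i) = dA₁ i) (hVB₁ : ∀ j, dV (Fin.natAdd 1 j) = dB₁ j)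
    [MeasurableSpace (unipDelta L eB₁ dB₁ hdB₁ dW hdW)] [BorelSpace (unipDelta L eB₁ dB₁ hdB₁ dW hdW)]
    -- the Levi chart BY VALUE (★ `exists_leviHom`)
    (Λ₁ : GL (Fin 2) (AdeleRing (𝓞 L) L) →* HA L e dV hdV dW hdW)
    (hΛ₁ : ∀ g : GL (Fin 2) (AdeleRing (𝓞 L) L), blk L e dV hdV dW hdW (Λ₁ g) =
      cayR (AdeleRing (𝓞 L) L) (Fin 2) * Matrix.fromBlocks (g : Matrix (Fin 2) (Fin 2) (AdeleRing (𝓞 L) L)) 0 0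
        (((gramR L e dV hdV dW hdW).map ((algebraMap L (AdeleRing (𝓞 L) L)).comp (algebraMap (Fp L) L)))⁻¹ *
          (((g⁻¹ : GL (Fin 2) (AdeleRing (𝓞 L) L)) : Matrix (Fin 2) (Fin 2) (AdeleRing (𝓞 L) L)).map
            (conjAdele (Fp L) L (IsCMField.complexConj L)))ᵀ *
          (gramR L e dV hdV dW hdW).map ((algebraMap L (AdeleRing (𝓞 L) L)).comp (algebraMap (Fp L) L))) *
        cayRinv (AdeleRing (𝓞 L) L) (Fin 2))
    -- the additive Haar measure on `𝔸_{L⁺}` and the line chart of `H(B)` BY VALUE (★ p862662 `exists_lineChart`)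
    (μ₁ : Measure (AdeleRing (𝓞 (Fp L)) (Fp L))) [μ₁.IsAddHaarMeasure]
    (nB₁ : AdeleRing (𝓞 (Fp L)) (Fp L) → unipDelta L eB₁ dB₁ hdB₁ dW hdW) (hnBc₁ : Continuous nB₁) (hnBadd₁ : ∀ s t, nB₁ (s + t) = nB₁ s * nB₁ t)
    (hnB₁ : ∀ t, (blk L eB₁ dB₁ hdB₁ dW hdW (nB₁ t : HA L eB₁ dB₁ hdB₁ dW hdW)).toBlocks₁₂ =
      Matrix.of fun _ _ => AdeleRing.baseChange (Fp L) L t * algebraMap L (AdeleRing (𝓞 L) L) (imagUnit L))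
    -- the row section BY VALUE (★ `exists_rowSection`)
    (γ₁ : Projectivization L (Fin 2 → L) → GL (Fin 2) L)
    (hγ₁ : ∀ p, Projectivization.mk L ((γ₁ p : Matrix (Fin 2) (Fin 2) L) 1) (row_ne_zero (γ₁ p) 1) = p)
    -- FRAME 2
    -- the see-saw datum `V = A ⊕ B` BY VALUE (the writer takes `eA₂ = eB₂` the unique equivalence, `dA₂ _ := dV 0`, `dB₂ _ := dV 1`, `borel` instances)
    {m₁ m₂ : ℕ} (eA₂ : Fin 1 × Fin 1 ≃ Fin m₁) (eB₂ : Fin 1 × Fin 1 ≃ Fin m₂)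
    (dA₂ : Fin 1 → L) (hdA₂ : ∀ i, IsCMField.complexConj L (dA₂ i) = dA₂ i)
    (dB₂ : Fin 1 → L) (hdB₂ : ∀ i, IsCMField.complexConj L (dB₂ i) = dB₂ i) (hdB0₂ : ∀ i, dB₂ i ≠ 0)
    (hVA₂ : ∀ i, dV (Fin.castAdd 1 i) = dA₂ i) (hVB₂ : ∀ j, dV (Fin.natAdd 1 j) = dB₂ j)
    [MeasurableSpace (unipDelta L eB₂ dB₂ hdB₂ dW hdW)] [BorelSpace (unipDelta L eB₂ dB₂ hdB₂ dW hdW)]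
    -- the Levi chart BY VALUE (★ `exists_leviHom`)
    (Λ₂ : GL (Fin 2) (AdeleRing (𝓞 L) L) →* HA L e dV hdV dW hdW)
    (hΛ₂ : ∀ g : GL (Fin 2) (AdeleRing (𝓞 L) L), blk L e dV hdV dW hdW (Λ₂ g) =
      cayR (AdeleRing (𝓞 L) L) (Fin 2) * Matrix.fromBlocks (g : Matrix (Fin 2) (Fin 2) (AdeleRing (𝓞 L) L)) 0 0
        (((gramR L e dV hdV dW hdW).map ((algebraMap L (AdeleRing (𝓞 L) L)).comp (algebraMap (Fp L) L)))⁻¹ *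
          (((g⁻¹ : GL (Fin 2) (AdeleRing (𝓞 L) L)) : Matrix (Fin 2) (Fin 2) (AdeleRing (𝓞 L) L)).map
            (conjAdele (Fp L) L (IsCMField.complexConj L)))ᵀ *
          (gramR L e dV hdV dW hdW).map ((algebraMap L (AdeleRing (𝓞 L) L)).comp (algebraMap (Fp L) L))) *
        cayRinv (AdeleRing (𝓞 L) L) (Fin 2))
    -- the additive Haar measure on `𝔸_{L⁺}` and the line chart of `H(B)` BY VALUE (★ p862662 `exists_lineChart`)
    (μ₂ : Measure (AdeleRing (𝓞 (Fp L)) (Fp L))) [μ₂.IsAddHaarMeasure]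
    (nB₂ : AdeleRing (𝓞 (Fp L)) (Fp L) → unipDelta L eB₂ dB₂ hdB₂ dW hdW) (hnBc₂ : Continuous nB₂) (hnBadd₂ : ∀ s t, nB₂ (s + t) = nB₂ s * nB₂ t)
    (hnB₂ : ∀ t, (blk L eB₂ dB₂ hdB₂ dW hdW (nB₂ t : HA L eB₂ dB₂ hdB₂ dW hdW)).toBlocks₁₂ =
      Matrix.of fun _ _ => AdeleRing.baseChange (Fp L) L t * algebraMap L (AdeleRing (𝓞 L) L) (imagUnit L))
    -- the row section BY VALUE (★ `exists_rowSection`)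
    (γ₂ : Projectivization L (Fin 2 → L) → GL (Fin 2) L)
    (hγ₂ : ∀ p, Projectivization.mk L ((γ₂ p : Matrix (Fin 2) (Fin 2) L) 1) (row_ne_zero (γ₂ p) 1) = p)
    : ∃ c : ℝ, 0 < c ∧
      ∀ (S : skewMatrices ((IsCMField.complexConj L : L ≃ₐ[Fp L] L) : L →+* L) ((gramR L e dV hdV dW hdW).map (algebraMap (Fp L) L)))
        {u w : Fin 2 → L} (_ : (S : Matrix (Fin 2) (Fin 2) L) = Matrix.vecMulVec u w) (_ : u ≠ 0) (hw : w ≠ 0)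
        (S'₁ : Matrix (Fin 2) (Fin 2) L)
        (_ : (∀ v : HA L e dV hdV dW hdW, v ∈ unipDelta L e dV hdV dW hdW →
          unipDeltaChar L e dV hdV dW hdW (S : Matrix (Fin 2) (Fin 2) L)
              ((Λ₁ (Matrix.GeneralLinearGroup.map (algebraMap L (AdeleRing (𝓞 L) L)) (γ₁ (Projectivization.mk L w hw))))⁻¹ * v *
                Λ₁ (Matrix.GeneralLinearGroup.map (algebraMap L (AdeleRing (𝓞 L) L)) (γ₁ (Projectivization.mk L w hw)))) =
            unipDeltaChar L e dV hdV dW hdW S'₁ v))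
        (S'₂ : Matrix (Fin 2) (Fin 2) L)
        (_ : (∀ v : HA L e dV hdV dW hdW, v ∈ unipDelta L e dV hdV dW hdW →
          unipDeltaChar L e dV hdV dW hdW (S : Matrix (Fin 2) (Fin 2) L)
              ((Λ₂ (Matrix.GeneralLinearGroup.map (algebraMap L (AdeleRing (𝓞 L) L)) (γ₂ (Projectivization.mk L w hw))))⁻¹ * v *
                Λ₂ (Matrix.GeneralLinearGroup.map (algebraMap L (AdeleRing (𝓞 L) L)) (γ₂ (Projectivization.mk L w hw)))) =
            unipDeltaChar L e dV hdV dW hdW S'₂ v))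
        {s : ℂ} (_ : 0 < s.re) (x : HA L e dV hdV dW hdW),
        whittakerDelta L eB₂ dB₂ hdB₂ dW hdW (Measure.map nB₂ μ₂) ((Matrix.reindex (idxSplit e eA₂ eB₂) (idxSplit e eA₂ eB₂) S'₂).toBlocks₂₂)
          (fun y => f s (blkD L e eA₂ eB₂ dA₂ hdA₂ dB₂ hdB₂ dV hdV hVA₂ hVB₂ dW hdW (1, y) *
            (Λ₂ (Matrix.GeneralLinearGroup.map (algebraMap L (AdeleRing (𝓞 L) L)) (γ₂ (Projectivization.mk L w hw))) * x))) 1 =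
        c • whittakerDelta L eB₁ dB₁ hdB₁ dW hdW (Measure.map nB₁ μ₁) ((Matrix.reindex (idxSplit e eA₁ eB₁) (idxSplit e eA₁ eB₁) S'₁).toBlocks₂₂)
          (fun y => f s (blkD L e eA₁ eB₁ dA₁ hdA₁ dB₁ hdB₁ dV hdV hVA₁ hVB₁ dW hdW (1, y) *
            (Λ₁ (Matrix.GeneralLinearGroup.map (algebraMap L (AdeleRing (𝓞 L) L)) (γ₁ (Projectivization.mk L w hw))) * x))) 1 := by
  -- the TOP's character is unitary; the line data have `n₁ = n₂`
  have hχ : (toHeckeCharacter L lam⁻¹).IsUnitary := isUnitary_toHeckeCharacter L lam⁻¹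
  have hn₁ : n₁ = n₂ := by
    have hA : Fintype.card (Fin 1 × Fin 1) = Fintype.card (Fin n₁) := Fintype.card_congr eA₁
    have hB : Fintype.card (Fin 1 × Fin 1) = Fintype.card (Fin n₂) := Fintype.card_congr eB₁
    simp only [Fintype.card_prod, Fintype.card_fin] at hA hB
    omega
  have hn₂ : m₁ = m₂ := by
    have hA : Fintype.card (Fin 1 × Fin 1) = Fintype.card (Fin m₁) := Fintype.card_congr eA₂
    have hB : Fintype.card (Fin 1 × Fin 1) = Fintype.card (Fin m₂) := Fintype.card_congr eB₂
    simp only [Fintype.card_prod, Fintype.card_fin] at hA hB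
    omega
  -- the middle reflection and the stabiliser lattice with a covering weight (shared by both frames)
  obtain ⟨g₀, hg₀, -⟩ := exists_reflStd L e dV dW
  obtain ⟨Γ₀, β₁, hΓ₀, hβ₁⟩ := exists_stabilizer_coveringWeight L e dV hdV dW hdW
    (⟨iotaGG L e dV hdV dW hdW (1, UnitaryGroup.rationalPairToAdelic (Fp L) L (IsCMField.complexConj L) 2 1 (Matrix.diagonal dV) (Matrix.diagonal dW) g₀),
      iotaGG_one_mem_ratH L e dV hdV dW hdW g₀⟩ : ratH L e dV hdV dW hdW)
  haveI : (Measure.map nB₁ μ₁).IsHaarMeasure := isHaarMeasure_map_lineChart L eB₁ dB₁ hdB₁ dW hdW hdB0₁ hdW0 μ₁ nB₁ hnBc₁ hnBadd₁ hnB₁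
  haveI : (Measure.map nB₂ μ₂).IsHaarMeasure := isHaarMeasure_map_lineChart L eB₂ dB₂ hdB₂ dW hdW hdB0₂ hdW0 μ₂ nB₂ hnBc₂ hnBadd₂ hnB₂
  -- the two constants of ★ p862785 (one per frame, each BEFORE `γ, S'`)
  have hmid₁ := exists_middle_cell_rankOne_eq_whittakerDelta_line eA₁ eB₁ dA₁ hdA₁ dB₁ hdB₁ hVA₁ hVB₁
    (hg₀ := hg₀) (Λ := Λ₁) (hΛ := hΛ₁) (Γ₀ := Γ₀) (hΓ₀ := hΓ₀) (wq := wq) (hwq := hwq) hdV0 hdW0 he νN μ₁ nB₁ hnBc₁ hnB₁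
  obtain ⟨C₁, hC₁0, hC₁top, hmain₁⟩ := hmid₁
  have hmid₂ := exists_middle_cell_rankOne_eq_whittakerDelta_line eA₂ eB₂ dA₂ hdA₂ dB₂ hdB₂ hVA₂ hVB₂
    (hg₀ := hg₀) (Λ := Λ₂) (hΛ := hΛ₂) (Γ₀ := Γ₀) (hΓ₀ := hΓ₀) (wq := wq) (hwq := hwq) hdV0 hdW0 he νN μ₂ nB₂ hnBc₂ hnB₂
  obtain ⟨C₂, hC₂0, hC₂top, hmain₂⟩ := hmid₂
  have hC₁r : 0 < C₁.toReal := ENNReal.toReal_pos hC₁0 hC₁top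
  have hC₂r : 0 < C₂.toReal := ENNReal.toReal_pos hC₂0 hC₂top
  refine ⟨C₁.toReal / C₂.toReal, div_pos hC₁r hC₂r, fun S u w hS1 hu hw S'₁ hψ₁ S'₂ hψ₂ s hs x => ?_⟩
  -- both values are holomorphic in `s` on the window; compare them on `{1 < re s}` through the middle term
  have hhol₂ : DifferentiableOn ℂ (fun s : ℂ => whittakerDelta L eB₂ dB₂ hdB₂ dW hdW (Measure.map nB₂ μ₂) ((Matrix.reindex (idxSplit e eA₂ eB₂) (idxSplit e eA₂ eB₂) S'₂).toBlocks₂₂)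
        (fun y => f s (blkD L e eA₂ eB₂ dA₂ hdA₂ dB₂ hdB₂ dV hdV hVA₂ hVB₂ dW hdW (1, y) *
          (Λ₂ (Matrix.GeneralLinearGroup.map (algebraMap L (AdeleRing (𝓞 L) L)) (γ₂ (Projectivization.mk L w hw))) * x))) 1) {s : ℂ | 0 < s.re} := by
    have h := differentiableOn_whittakerDelta_cornerTranslate_line (N₁ := 1) (N₂ := 1) (M := 1) (n := 2) L e eA₂ eB₂ dA₂ hdA₂ dB₂ hdB₂ dV hdV hVA₂ hVB₂ dW hdW
      hdB0₂ hdW0 hn₂ (𝒦 := 𝒦) (χ := toHeckeCharacter L lam⁻¹) (f := f) hχ hstd hcont (p₀ := 1) (isSiegelDelta_one' L e dV hdV dW hdW)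
      (Λ₂ (Matrix.GeneralLinearGroup.map (algebraMap L (AdeleRing (𝓞 L) L)) (γ₂ (Projectivization.mk L w hw))) * x) (Measure.map nB₂ μ₂)
      ((Matrix.reindex (idxSplit e eA₂ eB₂) (idxSplit e eA₂ eB₂) S'₂).toBlocks₂₂) 1
    simp only [one_mul] at h
    exact h
  have hhol₁ : DifferentiableOn ℂ (fun s : ℂ => whittakerDelta L eB₁ dB₁ hdB₁ dW hdW (Measure.map nB₁ μ₁) ((Matrix.reindex (idxSplit e eA₁ eB₁) (idxSplit e eA₁ eB₁) S'₁).toBlocks₂₂)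
        (fun y => f s (blkD L e eA₁ eB₁ dA₁ hdA₁ dB₁ hdB₁ dV hdV hVA₁ hVB₁ dW hdW (1, y) *
          (Λ₁ (Matrix.GeneralLinearGroup.map (algebraMap L (AdeleRing (𝓞 L) L)) (γ₁ (Projectivization.mk L w hw))) * x))) 1) {s : ℂ | 0 < s.re} := by
    have h := differentiableOn_whittakerDelta_cornerTranslate_line (N₁ := 1) (N₂ := 1) (M := 1) (n := 2) L e eA₁ eB₁ dA₁ hdA₁ dB₁ hdB₁ dV hdV hVA₁ hVB₁ dW hdW
      hdB0₁ hdW0 hn₁ (𝒦 := 𝒦) (χ := toHeckeCharacter L lam⁻¹) (f := f) hχ hstd hcont (p₀ := 1) (isSiegelDelta_one' L e dV hdV dW hdW)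
      (Λ₁ (Matrix.GeneralLinearGroup.map (algebraMap L (AdeleRing (𝓞 L) L)) (γ₁ (Projectivization.mk L w hw))) * x) (Measure.map nB₁ μ₁)
      ((Matrix.reindex (idxSplit e eA₁ eB₁) (idxSplit e eA₁ eB₁) S'₁).toBlocks₂₂) 1
    simp only [one_mul] at h
    exact h
  refine eq_of_eq_on_one_lt (E₁ := fun s : ℂ => whittakerDelta L eB₂ dB₂ hdB₂ dW hdW (Measure.map nB₂ μ₂) ((Matrix.reindex (idxSplit e eA₂ eB₂) (idxSplit e eA₂ eB₂) S'₂).toBlocks₂₂)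
        (fun y => f s (blkD L e eA₂ eB₂ dA₂ hdA₂ dB₂ hdB₂ dV hdV hVA₂ hVB₂ dW hdW (1, y) *
          (Λ₂ (Matrix.GeneralLinearGroup.map (algebraMap L (AdeleRing (𝓞 L) L)) (γ₂ (Projectivization.mk L w hw))) * x))) 1)
    (E₂ := fun s : ℂ => (C₁.toReal / C₂.toReal) • whittakerDelta L eB₁ dB₁ hdB₁ dW hdW (Measure.map nB₁ μ₁) ((Matrix.reindex (idxSplit e eA₁ eB₁) (idxSplit e eA₁ eB₁) S'₁).toBlocks₂₂)
        (fun y => f s (blkD L e eA₁ eB₁ dA₁ hdA₁ dB₁ hdB₁ dV hdV hVA₁ hVB₁ dW hdW (1, y) *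
          (Λ₁ (Matrix.GeneralLinearGroup.map (algebraMap L (AdeleRing (𝓞 L) L)) (γ₁ (Projectivization.mk L w hw))) * x))) 1)
    hhol₂ (hhol₁.const_smul (C₁.toReal / C₂.toReal)) (fun t ht => ?_) hs
  have ht' : ((2 : ℕ) : ℝ) / 2 < t.re := by norm_num; exact ht
  have hH := lintegral_tsum_enorm_mul_weight_ne_top L e dV hdV dW hdW hdV0 hdW0 hχ ht' (hstd.1.1 t) (hcont t) νN hβtop hK hβK x
  have k₁ := hmain₁ hβ₁ hβ (hstd.1.1 t) (hcont t) (fun g => measurePreserving_conj_levi Λ₁ hΛ₁ hdV0 hdW0 νN g) S.2 hS1 hu hw γ₁ hγ₁ S'₁ hψ₁ x hH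
  have k₂ := hmain₂ hβ₁ hβ (hstd.1.1 t) (hcont t) (fun g => measurePreserving_conj_levi Λ₂ hΛ₂ hdV0 hdW0 νN g) S.2 hS1 hu hw γ₂ hγ₂ S'₂ hψ₂ x hH
  -- `C₂ • W₂ = MID = C₁ • W₁`, so `W₂ = (C₁ ∕ C₂) • W₁`
  have h12 := k₂.symm.trans k₁
  have hc : C₂.toReal * (C₁.toReal / C₂.toReal) = C₁.toReal := by field_simp
  apply eq_of_real_smul_eq hC₂r.ne'
  rw [smul_smul, hc]
  exact h12

/-- **(dec-0′) THE FULL FRAME CHANGE** (`inl` enumeration `e (1,0) = 0`).  Socket prefix of #41 at `n = 2`; TWO frames `F₁ = (eA₁ eB₁ dA₁ dB₁, Λ₁, μ₁, nB₁, γ₁)`,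
`F₂ = (…₂)` BY VALUE (★ p863230's frame bytes, twice).  THEN `∃ c > 0` such that for every rank-one `T_L`-skew `S = u ⊗ w`, transported indices `S'₁` (w.r.t. `Λ₁γ₁[w]`),
`S'₂` (w.r.t. `Λ₂γ₂[w]`), every `s` with `0 < re s` and every `x`: `W(F₂)(s, x) = c • W(F₁)(s, x)`.  (`c = C₁ ∕ C₂` for the two ★ p862785 constants; equality on `{1 < re s}` through the
middle term, continued by ★ p862749 ∕ ★ p863263 §2 and `eq_of_eq_on_one_lt`.) [cite: KudlaRallis1994, §2 (2.10)–(2.12)] [cite: MoeglinWaldspurger1995, II.1.7, IV.1.9] [cite: Conway1978, IV.3] -/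
theorem exists_whittakerDelta_line_eq_smul_of_frames_inl
    (L : Type) [Field L] [NumberField L] [IsCMField L] (e : Fin 2 × Fin 1 ≃ Fin 2)
    (dV : Fin 2 → L) (hdV : ∀ i, IsCMField.complexConj L (dV i) = dV i) (hdV0 : ∀ i, dV i ≠ 0)
    (dW : Fin 1 → L) (hdW : ∀ i, IsCMField.complexConj L (dW i) = dW i) (hdW0 : ∀ i, dW i ≠ 0)
    (lam : IdeleClassGroup L →ₜ* Circle) (_hlam : IsConjugateSymplectic L lam) (_hw : HasWeight L lam 1)
    (𝒦 : IwasawaDatum L e dV hdV dW hdW) (_h𝒦 : 𝒦.IsStd) (f : ℂ → HA L e dV hdV dW hdW → ℂ)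
    (hstd : IsStandardSectionFamily 𝒦 (toHeckeCharacter L lam⁻¹) f) (hcont : ∀ s, Continuous (f s))
    [MeasurableSpace (unipDelta L e dV hdV dW hdW)] [BorelSpace (unipDelta L e dV hdV dW hdW)]
    (νN : Measure (unipDelta L e dV hdV dW hdW)) [νN.IsHaarMeasure]
    (β : unipDelta L e dV hdV dW hdW → ℝ≥0∞) (hβ : IsCoveringWeight (unipDeltaRat L e dV hdV dW hdW) β)
    (_hβ0 : ∫⁻ u, β u ∂νN ≠ 0) (hβtop : ∫⁻ u, β u ∂νN ≠ ∞)
    {K : Set (unipDelta L e dV hdV dW hdW)} (hK : IsCompact K) (hβK : ∀ u, β u ≤ K.indicator 1 u)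
    (wq : unipDeltaRat L e dV hdV dW hdW → ratH L e dV hdV dW hdW)
    (hwq : ∀ ν, ((wq ν : ratH L e dV hdV dW hdW) : HA L e dV hdV dW hdW) = weylDelta L e dV hdV dW hdW * ((ν : unipDelta L e dV hdV dW hdW) : HA L e dV hdV dW hdW))
    -- the enumeration (shared by both frames)
    (he : e (1, 0) = 0)
    [MeasurableSpace (AdeleRing (𝓞 (Fp L)) (Fp L))] [BorelSpace (AdeleRing (𝓞 (Fp L)) (Fp L))]
    -- FRAME 1
    -- the see-saw datum `V = A ⊕ B` BY VALUE (the writer takes `eA₁ = eB₁` the unique equivalence, `dA₁ _ := dV 0`, `dB₁ _ := dV 1`, `borel` instances)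
    {n₁ n₂ : ℕ} (eA₁ : Fin 1 × Fin 1 ≃ Fin n₁) (eB₁ : Fin 1 × Fin 1 ≃ Fin n₂)
    (dA₁ : Fin 1 → L) (hdA₁ : ∀ i, IsCMField.complexConj L (dA₁ i) = dA₁ i)
    (dB₁ : Fin 1 → L) (hdB₁ : ∀ i, IsCMField.complexConj L (dB₁ i) = dB₁ i) (hdA0₁ : ∀ i, dA₁ i ≠ 0)
    (hVA₁ : ∀ i, dV (Fin.castAdd 1 i) = dA₁ i) (hVB₁ : ∀ j, dV (Fin.natAdd 1 j) = dB₁ j)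
    [MeasurableSpace (unipDelta L eA₁ dA₁ hdA₁ dW hdW)] [BorelSpace (unipDelta L eA₁ dA₁ hdA₁ dW hdW)]
    -- the Levi chart BY VALUE (★ `exists_leviHom`)
    (Λ₁ : GL (Fin 2) (AdeleRing (𝓞 L) L) →* HA L e dV hdV dW hdW)
    (hΛ₁ : ∀ g : GL (Fin 2) (AdeleRing (𝓞 L) L), blk L e dV hdV dW hdW (Λ₁ g) =
      cayR (AdeleRing (𝓞 L) L) (Fin 2) * Matrix.fromBlocks (g : Matrix (Fin 2) (Fin 2) (AdeleRing (𝓞 L) L)) 0 0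
        (((gramR L e dV hdV dW hdW).map ((algebraMap L (AdeleRing (𝓞 L) L)).comp (algebraMap (Fp L) L)))⁻¹ *
          (((g⁻¹ : GL (Fin 2) (AdeleRing (𝓞 L) L)) : Matrix (Fin 2) (Fin 2) (AdeleRing (𝓞 L) L)).map
            (conjAdele (Fp L) L (IsCMField.complexConj L)))ᵀ *
          (gramR L e dV hdV dW hdW).map ((algebraMap L (AdeleRing (𝓞 L) L)).comp (algebraMap (Fp L) L))) *
        cayRinv (AdeleRing (𝓞 L) L) (Fin 2))
    -- the additive Haar measure on `𝔸_{L⁺}` and the line chart of `H(B)` BY VALUE (★ p862662 `exists_lineChart`)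
    (μ₁ : Measure (AdeleRing (𝓞 (Fp L)) (Fp L))) [μ₁.IsAddHaarMeasure]
    (nB₁ : AdeleRing (𝓞 (Fp L)) (Fp L) → unipDelta L eA₁ dA₁ hdA₁ dW hdW) (hnBc₁ : Continuous nB₁) (hnBadd₁ : ∀ s t, nB₁ (s + t) = nB₁ s * nB₁ t)
    (hnB₁ : ∀ t, (blk L eA₁ dA₁ hdA₁ dW hdW (nB₁ t : HA L eA₁ dA₁ hdA₁ dW hdW)).toBlocks₁₂ =
      Matrix.of fun _ _ => AdeleRing.baseChange (Fp L) L t * algebraMap L (AdeleRing (𝓞 L) L) (imagUnit L))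
    -- the row section BY VALUE (★ `exists_rowSection`)
    (γ₁ : Projectivization L (Fin 2 → L) → GL (Fin 2) L)
    (hγ₁ : ∀ p, Projectivization.mk L ((γ₁ p : Matrix (Fin 2) (Fin 2) L) 1) (row_ne_zero (γ₁ p) 1) = p)
    -- FRAME 2
    -- the see-saw datum `V = A ⊕ B` BY VALUE (the writer takes `eA₂ = eB₂` the unique equivalence, `dA₂ _ := dV 0`, `dB₂ _ := dV 1`, `borel` instances)
    {m₁ m₂ : ℕ} (eA₂ : Fin 1 × Fin 1 ≃ Fin m₁) (eB₂ : Fin 1 × Fin 1 ≃ Fin m₂)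
    (dA₂ : Fin 1 → L) (hdA₂ : ∀ i, IsCMField.complexConj L (dA₂ i) = dA₂ i)
    (dB₂ : Fin 1 → L) (hdB₂ : ∀ i, IsCMField.complexConj L (dB₂ i) = dB₂ i) (hdA0₂ : ∀ i, dA₂ i ≠ 0)
    (hVA₂ : ∀ i, dV (Fin.castAdd 1 i) = dA₂ i) (hVB₂ : ∀ j, dV (Fin.natAdd 1 j) = dB₂ j)
    [MeasurableSpace (unipDelta L eA₂ dA₂ hdA₂ dW hdW)] [BorelSpace (unipDelta L eA₂ dA₂ hdA₂ dW hdW)]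
    -- the Levi chart BY VALUE (★ `exists_leviHom`)
    (Λ₂ : GL (Fin 2) (AdeleRing (𝓞 L) L) →* HA L e dV hdV dW hdW)
    (hΛ₂ : ∀ g : GL (Fin 2) (AdeleRing (𝓞 L) L), blk L e dV hdV dW hdW (Λ₂ g) =
      cayR (AdeleRing (𝓞 L) L) (Fin 2) * Matrix.fromBlocks (g : Matrix (Fin 2) (Fin 2) (AdeleRing (𝓞 L) L)) 0 0
        (((gramR L e dV hdV dW hdW).map ((algebraMap L (AdeleRing (𝓞 L) L)).comp (algebraMap (Fp L) L)))⁻¹ *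
          (((g⁻¹ : GL (Fin 2) (AdeleRing (𝓞 L) L)) : Matrix (Fin 2) (Fin 2) (AdeleRing (𝓞 L) L)).map
            (conjAdele (Fp L) L (IsCMField.complexConj L)))ᵀ *
          (gramR L e dV hdV dW hdW).map ((algebraMap L (AdeleRing (𝓞 L) L)).comp (algebraMap (Fp L) L))) *
        cayRinv (AdeleRing (𝓞 L) L) (Fin 2))
    -- the additive Haar measure on `𝔸_{L⁺}` and the line chart of `H(B)` BY VALUE (★ p862662 `exists_lineChart`)
    (μ₂ : Measure (AdeleRing (𝓞 (Fp L)) (Fp L))) [μ₂.IsAddHaarMeasure]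
    (nB₂ : AdeleRing (𝓞 (Fp L)) (Fp L) → unipDelta L eA₂ dA₂ hdA₂ dW hdW) (hnBc₂ : Continuous nB₂) (hnBadd₂ : ∀ s t, nB₂ (s + t) = nB₂ s * nB₂ t)
    (hnB₂ : ∀ t, (blk L eA₂ dA₂ hdA₂ dW hdW (nB₂ t : HA L eA₂ dA₂ hdA₂ dW hdW)).toBlocks₁₂ =
      Matrix.of fun _ _ => AdeleRing.baseChange (Fp L) L t * algebraMap L (AdeleRing (𝓞 L) L) (imagUnit L))
    -- the row section BY VALUE (★ `exists_rowSection`)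
    (γ₂ : Projectivization L (Fin 2 → L) → GL (Fin 2) L)
    (hγ₂ : ∀ p, Projectivization.mk L ((γ₂ p : Matrix (Fin 2) (Fin 2) L) 1) (row_ne_zero (γ₂ p) 1) = p)
    : ∃ c : ℝ, 0 < c ∧
      ∀ (S : skewMatrices ((IsCMField.complexConj L : L ≃ₐ[Fp L] L) : L →+* L) ((gramR L e dV hdV dW hdW).map (algebraMap (Fp L) L)))
        {u w : Fin 2 → L} (_ : (S : Matrix (Fin 2) (Fin 2) L) = Matrix.vecMulVec u w) (_ : u ≠ 0) (hw : w ≠ 0)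
        (S'₁ : Matrix (Fin 2) (Fin 2) L)
        (_ : (∀ v : HA L e dV hdV dW hdW, v ∈ unipDelta L e dV hdV dW hdW →
          unipDeltaChar L e dV hdV dW hdW (S : Matrix (Fin 2) (Fin 2) L)
              ((Λ₁ (Matrix.GeneralLinearGroup.map (algebraMap L (AdeleRing (𝓞 L) L)) (γ₁ (Projectivization.mk L w hw))))⁻¹ * v *
                Λ₁ (Matrix.GeneralLinearGroup.map (algebraMap L (AdeleRing (𝓞 L) L)) (γ₁ (Projectivization.mk L w hw)))) =
            unipDeltaChar L e dV hdV dW hdW S'₁ v))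
        (S'₂ : Matrix (Fin 2) (Fin 2) L)
        (_ : (∀ v : HA L e dV hdV dW hdW, v ∈ unipDelta L e dV hdV dW hdW →
          unipDeltaChar L e dV hdV dW hdW (S : Matrix (Fin 2) (Fin 2) L)
              ((Λ₂ (Matrix.GeneralLinearGroup.map (algebraMap L (AdeleRing (𝓞 L) L)) (γ₂ (Projectivization.mk L w hw))))⁻¹ * v *
                Λ₂ (Matrix.GeneralLinearGroup.map (algebraMap L (AdeleRing (𝓞 L) L)) (γ₂ (Projectivization.mk L w hw)))) =
            unipDeltaChar L e dV hdV dW hdW S'₂ v))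
        {s : ℂ} (_ : 0 < s.re) (x : HA L e dV hdV dW hdW),
        whittakerDelta L eA₂ dA₂ hdA₂ dW hdW (Measure.map nB₂ μ₂) ((Matrix.reindex (idxSplit e eA₂ eB₂) (idxSplit e eA₂ eB₂) S'₂).toBlocks₁₁)
          (fun y => f s (blkD L e eA₂ eB₂ dA₂ hdA₂ dB₂ hdB₂ dV hdV hVA₂ hVB₂ dW hdW (y, 1) *
            (Λ₂ (Matrix.GeneralLinearGroup.map (algebraMap L (AdeleRing (𝓞 L) L)) (γ₂ (Projectivization.mk L w hw))) * x))) 1 =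
        c • whittakerDelta L eA₁ dA₁ hdA₁ dW hdW (Measure.map nB₁ μ₁) ((Matrix.reindex (idxSplit e eA₁ eB₁) (idxSplit e eA₁ eB₁) S'₁).toBlocks₁₁)
          (fun y => f s (blkD L e eA₁ eB₁ dA₁ hdA₁ dB₁ hdB₁ dV hdV hVA₁ hVB₁ dW hdW (y, 1) *
            (Λ₁ (Matrix.GeneralLinearGroup.map (algebraMap L (AdeleRing (𝓞 L) L)) (γ₁ (Projectivization.mk L w hw))) * x))) 1 := by
  -- the TOP's character is unitary; the line data have `n₁ = n₂`
  have hχ : (toHeckeCharacter L lam⁻¹).IsUnitary := isUnitary_toHeckeCharacter L lam⁻¹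
  have hn₁ : n₁ = n₂ := by
    have hA : Fintype.card (Fin 1 × Fin 1) = Fintype.card (Fin n₁) := Fintype.card_congr eA₁
    have hB : Fintype.card (Fin 1 × Fin 1) = Fintype.card (Fin n₂) := Fintype.card_congr eB₁
    simp only [Fintype.card_prod, Fintype.card_fin] at hA hB
    omega
  have hn₂ : m₁ = m₂ := by
    have hA : Fintype.card (Fin 1 × Fin 1) = Fintype.card (Fin m₁) := Fintype.card_congr eA₂
    have hB : Fintype.card (Fin 1 × Fin 1) = Fintype.card (Fin m₂) := Fintype.card_congr eB₂
    simp only [Fintype.card_prod, Fintype.card_fin] at hA hB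
    omega
  -- the middle reflection and the stabiliser lattice with a covering weight (shared by both frames)
  obtain ⟨g₀, hg₀, -⟩ := exists_reflStd L e dV dW
  obtain ⟨Γ₀, β₁, hΓ₀, hβ₁⟩ := exists_stabilizer_coveringWeight L e dV hdV dW hdW
    (⟨iotaGG L e dV hdV dW hdW (1, UnitaryGroup.rationalPairToAdelic (Fp L) L (IsCMField.complexConj L) 2 1 (Matrix.diagonal dV) (Matrix.diagonal dW) g₀),
      iotaGG_one_mem_ratH L e dV hdV dW hdW g₀⟩ : ratH L e dV hdV dW hdW)
  haveI : (Measure.map nB₁ μ₁).IsHaarMeasure := isHaarMeasure_map_lineChart L eA₁ dA₁ hdA₁ dW hdW hdA0₁ hdW0 μ₁ nB₁ hnBc₁ hnBadd₁ hnB₁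
  haveI : (Measure.map nB₂ μ₂).IsHaarMeasure := isHaarMeasure_map_lineChart L eA₂ dA₂ hdA₂ dW hdW hdA0₂ hdW0 μ₂ nB₂ hnBc₂ hnBadd₂ hnB₂
  -- the two constants of ★ p862785 (one per frame, each BEFORE `γ, S'`)
  have hmid₁ := exists_middle_cell_rankOne_eq_whittakerDelta_line_inl eA₁ eB₁ dA₁ hdA₁ dB₁ hdB₁ hVA₁ hVB₁
    (hg₀ := hg₀) (Λ := Λ₁) (hΛ := hΛ₁) (Γ₀ := Γ₀) (hΓ₀ := hΓ₀) (wq := wq) (hwq := hwq) hdV0 hdW0 he νN μ₁ nB₁ hnBc₁ hnB₁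
  obtain ⟨C₁, hC₁0, hC₁top, hmain₁⟩ := hmid₁
  have hmid₂ := exists_middle_cell_rankOne_eq_whittakerDelta_line_inl eA₂ eB₂ dA₂ hdA₂ dB₂ hdB₂ hVA₂ hVB₂
    (hg₀ := hg₀) (Λ := Λ₂) (hΛ := hΛ₂) (Γ₀ := Γ₀) (hΓ₀ := hΓ₀) (wq := wq) (hwq := hwq) hdV0 hdW0 he νN μ₂ nB₂ hnBc₂ hnB₂
  obtain ⟨C₂, hC₂0, hC₂top, hmain₂⟩ := hmid₂
  have hC₁r : 0 < C₁.toReal := ENNReal.toReal_pos hC₁0 hC₁top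
  have hC₂r : 0 < C₂.toReal := ENNReal.toReal_pos hC₂0 hC₂top
  refine ⟨C₁.toReal / C₂.toReal, div_pos hC₁r hC₂r, fun S u w hS1 hu hw S'₁ hψ₁ S'₂ hψ₂ s hs x => ?_⟩
  -- both values are holomorphic in `s` on the window; compare them on `{1 < re s}` through the middle term
  have hhol₂ : DifferentiableOn ℂ (fun s : ℂ => whittakerDelta L eA₂ dA₂ hdA₂ dW hdW (Measure.map nB₂ μ₂) ((Matrix.reindex (idxSplit e eA₂ eB₂) (idxSplit e eA₂ eB₂) S'₂).toBlocks₁₁)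
        (fun y => f s (blkD L e eA₂ eB₂ dA₂ hdA₂ dB₂ hdB₂ dV hdV hVA₂ hVB₂ dW hdW (y, 1) *
          (Λ₂ (Matrix.GeneralLinearGroup.map (algebraMap L (AdeleRing (𝓞 L) L)) (γ₂ (Projectivization.mk L w hw))) * x))) 1) {s : ℂ | 0 < s.re} := 
    differentiableOn_whittakerDelta_blkD_inl_line (N₁ := 1) (N₂ := 1) (M := 1) (n := 2) L e eA₂ eB₂ dA₂ hdA₂ dB₂ hdB₂ dV hdV hVA₂ hVB₂ dW hdW
      hdA0₂ hdW0 hn₂ (𝒦 := 𝒦) (χ := toHeckeCharacter L lam⁻¹) (f := f) hχ hstd hcont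
      (Λ₂ (Matrix.GeneralLinearGroup.map (algebraMap L (AdeleRing (𝓞 L) L)) (γ₂ (Projectivization.mk L w hw))) * x) (Measure.map nB₂ μ₂)
      ((Matrix.reindex (idxSplit e eA₂ eB₂) (idxSplit e eA₂ eB₂) S'₂).toBlocks₁₁) 1
  have hhol₁ : DifferentiableOn ℂ (fun s : ℂ => whittakerDelta L eA₁ dA₁ hdA₁ dW hdW (Measure.map nB₁ μ₁) ((Matrix.reindex (idxSplit e eA₁ eB₁) (idxSplit e eA₁ eB₁) S'₁).toBlocks₁₁)
        (fun y => f s (blkD L e eA₁ eB₁ dA₁ hdA₁ dB₁ hdB₁ dV hdV hVA₁ hVB₁ dW hdW (y, 1) *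
          (Λ₁ (Matrix.GeneralLinearGroup.map (algebraMap L (AdeleRing (𝓞 L) L)) (γ₁ (Projectivization.mk L w hw))) * x))) 1) {s : ℂ | 0 < s.re} := 
    differentiableOn_whittakerDelta_blkD_inl_line (N₁ := 1) (N₂ := 1) (M := 1) (n := 2) L e eA₁ eB₁ dA₁ hdA₁ dB₁ hdB₁ dV hdV hVA₁ hVB₁ dW hdW
      hdA0₁ hdW0 hn₁ (𝒦 := 𝒦) (χ := toHeckeCharacter L lam⁻¹) (f := f) hχ hstd hcont
      (Λ₁ (Matrix.GeneralLinearGroup.map (algebraMap L (AdeleRing (𝓞 L) L)) (γ₁ (Projectivization.mk L w hw))) * x) (Measure.map nB₁ μ₁)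
      ((Matrix.reindex (idxSplit e eA₁ eB₁) (idxSplit e eA₁ eB₁) S'₁).toBlocks₁₁) 1
  refine eq_of_eq_on_one_lt (E₁ := fun s : ℂ => whittakerDelta L eA₂ dA₂ hdA₂ dW hdW (Measure.map nB₂ μ₂) ((Matrix.reindex (idxSplit e eA₂ eB₂) (idxSplit e eA₂ eB₂) S'₂).toBlocks₁₁)
        (fun y => f s (blkD L e eA₂ eB₂ dA₂ hdA₂ dB₂ hdB₂ dV hdV hVA₂ hVB₂ dW hdW (y, 1) *
          (Λ₂ (Matrix.GeneralLinearGroup.map (algebraMap L (AdeleRing (𝓞 L) L)) (γ₂ (Projectivization.mk L w hw))) * x))) 1)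
    (E₂ := fun s : ℂ => (C₁.toReal / C₂.toReal) • whittakerDelta L eA₁ dA₁ hdA₁ dW hdW (Measure.map nB₁ μ₁) ((Matrix.reindex (idxSplit e eA₁ eB₁) (idxSplit e eA₁ eB₁) S'₁).toBlocks₁₁)
        (fun y => f s (blkD L e eA₁ eB₁ dA₁ hdA₁ dB₁ hdB₁ dV hdV hVA₁ hVB₁ dW hdW (y, 1) *
          (Λ₁ (Matrix.GeneralLinearGroup.map (algebraMap L (AdeleRing (𝓞 L) L)) (γ₁ (Projectivization.mk L w hw))) * x))) 1)
    hhol₂ (hhol₁.const_smul (C₁.toReal / C₂.toReal)) (fun t ht => ?_) hs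
  have ht' : ((2 : ℕ) : ℝ) / 2 < t.re := by norm_num; exact ht
  have hH := lintegral_tsum_enorm_mul_weight_ne_top L e dV hdV dW hdW hdV0 hdW0 hχ ht' (hstd.1.1 t) (hcont t) νN hβtop hK hβK x
  have k₁ := hmain₁ hβ₁ hβ (hstd.1.1 t) (hcont t) (fun g => measurePreserving_conj_levi Λ₁ hΛ₁ hdV0 hdW0 νN g) S.2 hS1 hu hw γ₁ hγ₁ S'₁ hψ₁ x hH
  have k₂ := hmain₂ hβ₁ hβ (hstd.1.1 t) (hcont t) (fun g => measurePreserving_conj_levi Λ₂ hΛ₂ hdV0 hdW0 νN g) S.2 hS1 hu hw γ₂ hγ₂ S'₂ hψ₂ x hH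
  -- `C₂ • W₂ = MID = C₁ • W₁`, so `W₂ = (C₁ ∕ C₂) • W₁`
  have h12 := k₂.symm.trans k₁
  have hc : C₂.toReal * (C₁.toReal / C₂.toReal) = C₁.toReal := by field_simp
  apply eq_of_real_smul_eq hC₂r.ne'
  rw [smul_smul, hc]
  exact h12

end Summit.HodgeConjecture.HodgeConjecture.Cruxes.HLiu418.K2LiuKindOneLineFrameChange

end
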